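import Literature.AlgebraicGeometry.Limits.RelativeDimensionFieldDescent
import Literature.AlgebraicGeometry.Motives.FiniteCoproductVarieties
import Literature.AlgebraicGeometry.Resolution.BaseChangeOverOpens
import HarnessLib

/-!
# «Smooth of relative dimension `n`» for a finite disjoint union, and for a `k`-scheme whose complexification is a disjoint
# union of smooth pieces (road (ii) leaf L3.5 F-SMPROJ of the cell hodgecm-mathlib)

Topic `AlgebraicGeometry/Limits`; namespace `Literature.AlgebraicGeometry.Limits`.  THEOREMS ONLY (no `def`, no named fact, no
instance, no `sorry`).

* `smoothOfRelativeDimension_hom_of_isColimit_cofan_baseChangeHom` — for a field homomorphism `σ : k →+* L` and a `k`-scheme `Z`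
  whose base change `Z ⊗_σ L` is the colimit of a cofan of `L`-schemes each smooth of relative dimension `n` over `L`, the structure
  morphism `Z → Spec k` is smooth of relative dimension `n`: the apex of the cofan is smooth of relative dimension `n` over `L`
  (★ `Motives.smoothOfRelativeDimension_of_isColimit_cofan`, [EGAIV4] 17.3.3 (ii): smoothness is local on the source, the legs being
  open immersions covering the apex) and smoothness with its relative dimension descends along `Spec L → Spec k`
  (★ `smoothOfRelativeDimension_hom_of_baseChangeHom_obj`, [EGAIV4] 17.7.4); `…_of_isSmoothProjective` — the pieces given as
  `Motives.IsSmoothProjective n`.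
* `smoothOfRelativeDimension_and_isProjectiveOver_of_closedSubscheme_of_cofan` — **leaf L3.5 of road (ii)** (A-p10's cut
  `CUT-R2-5-FIELDS` §2): a CLOSED SUBSCHEME `j : Z ⟶ M` of a projective `k`-scheme `M` whose complexification (base change along
  `σ : k →+* L`, e.g. `τ : L_CM →+* ℂ`) is a finite disjoint union of smooth projective `L`-schemes of dimension `n` is smooth of
  relative dimension `n` AND projective over `k` — the two record fields `smooth`/`projective` of ★ `RecordSystemGS` for the descended
  curve tower `M⋆_K ↪ M_K` (projectivity: ★ `Resolution.isProjectiveOver_of_isClosedImmersion_left`).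

## References
* [EGAIV4] A. Grothendieck, J. Dieudonné, *ÉGA IV₄* (1967), 17.3.3 (ii) (smoothness is local on the source), Prop. 17.7.4 (fpqc descent of
  smoothness and of its relative dimension).
* [GortzWedhorn2020] U. Görtz, T. Wedhorn, *Algebraic Geometry I* (2nd ed. 2020), §(3.5) Example 3.11 and §(3.11) (disjoint unions),
  §(6.14) (smooth morphisms of relative dimension `d`).
* [Hartshorne1977] R. Hartshorne, *Algebraic Geometry*, II §4 (closed subschemes of projective schemes are projective), III Prop. 10.1.
-/

noncomputable section

open CategoryTheory CategoryTheory.Limits AlgebraicGeometry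

namespace Literature.AlgebraicGeometry.Limits

universe u

/-! ### Descent along a field extension of a piecewise-smooth complexification -/

section Descent

variable {k L : Type u} [Field k] [Field L] (σ : k →+* L)

open Literature.AlgebraicGeometry.Motives (SchemeOver baseChangeHom IsSmoothProjective IsProjectiveOver)

/-- **A `k`-scheme whose base change to `L` is a disjoint union of pieces smooth of relative dimension `n` over `L` is smooth of relative
dimension `n` over `k`.** [cite: EGAIV4, Prop. 17.7.4 and 17.3.3 (ii)] [cite: GortzWedhorn2020, §(3.11)] -/
theorem smoothOfRelativeDimension_hom_of_isColimit_cofan_baseChangeHom (n : ℕ) (Z : SchemeOver k) {ι₀ : Type}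
    {X : ι₀ → SchemeOver L} {ι : ∀ i, X i ⟶ (baseChangeHom σ).obj Z}
    (hc : IsColimit (Cofan.mk ((baseChangeHom σ).obj Z) ι)) (h : ∀ i, SmoothOfRelativeDimension n (X i).hom) :
    SmoothOfRelativeDimension n Z.hom := by
  haveI : SmoothOfRelativeDimension n ((baseChangeHom σ).obj Z).hom :=
    Literature.AlgebraicGeometry.Motives.smoothOfRelativeDimension_of_isColimit_cofan hc h
  exact smoothOfRelativeDimension_hom_of_baseChangeHom_obj σ n Z

/-- The same with the pieces given as smooth projective `L`-varieties of dimension `n` (the tree's `Motives.IsSmoothProjective`).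
[cite: EGAIV4, Prop. 17.7.4] [cite: Hartshorne1977, III Prop. 10.1] -/
theorem smoothOfRelativeDimension_hom_of_isColimit_cofan_baseChangeHom_of_isSmoothProjective (n : ℕ) (Z : SchemeOver k)
    {ι₀ : Type} {X : ι₀ → SchemeOver L} {ι : ∀ i, X i ⟶ (baseChangeHom σ).obj Z}
    (hc : IsColimit (Cofan.mk ((baseChangeHom σ).obj Z) ι)) (h : ∀ i, IsSmoothProjective n (X i)) :
    SmoothOfRelativeDimension n Z.hom :=
  smoothOfRelativeDimension_hom_of_isColimit_cofan_baseChangeHom σ n Z hc fun i ↦ (h i).smoothOfRelativeDimension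

/-- **Leaf L3.5 F-SMPROJ of road (ii)** (cell hodgecm-mathlib, A-p10's cut `CUT-R2-5-FIELDS` §2): a closed subscheme `j : Z ⟶ M` of a
PROJECTIVE `k`-scheme `M` whose base change along `σ : k →+* L` is the colimit of a cofan of smooth projective `L`-schemes of dimension `n`
is SMOOTH OF RELATIVE DIMENSION `n` and PROJECTIVE over `k` — the two fields `smooth` / `projective` of a curve record (★ `RecordSystemGS`)
for the descended tower `M⋆_K ↪ M_K` (`n = 1`, `σ = τ`, pieces = the special curves `Z_{q,i}` of the surface pieces).
[cite: EGAIV4, Prop. 17.7.4] [cite: Hartshorne1977, II §4 and III Prop. 10.1] -/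
theorem smoothOfRelativeDimension_and_isProjectiveOver_of_closedSubscheme_of_cofan (n : ℕ) {Z M : SchemeOver k} (j : Z ⟶ M)
    [IsClosedImmersion j.left] (hM : IsProjectiveOver M)
    {ι₀ : Type} {X : ι₀ → SchemeOver L} {ι : ∀ i, X i ⟶ (baseChangeHom σ).obj Z}
    (hc : IsColimit (Cofan.mk ((baseChangeHom σ).obj Z) ι)) (h : ∀ i, IsSmoothProjective n (X i)) :
    SmoothOfRelativeDimension n Z.hom ∧ IsProjectiveOver Z :=
  ⟨smoothOfRelativeDimension_hom_of_isColimit_cofan_baseChangeHom_of_isSmoothProjective σ n Z hc h,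
    Literature.AlgebraicGeometry.Resolution.isProjectiveOver_of_isClosedImmersion_left j hM⟩

end Descent

end Literature.AlgebraicGeometry.Limits

end
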